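import Summits.HodgeConjecture.HodgeConjecture.Theorems.MarkmanPartnerTransportIsometrySpannedThirdScalarAllRanks

/-!
# Route MarkmanPartnerTransport · support #3 `IsometrySpannedThird` — the SELF-ADJOINT-SCALAR sector at every
# Picard rank, partner-free: HC⁴ for marked `K3^{[2]}`-type fourfolds whose `q`-self-adjoint rational Hodge
# endomorphisms of `T(X)` are scalars (`E = ℚ` OR `E` imaginary quadratic)

`…IsometrySpannedThirdScalarAllRanks` proves HC⁴(X) for marked smooth projective `K3^{[2]}`-type `X` assuming
EVERY rational Hodge endomorphism of `H²(X)` killing `N¹(X)` with transcendental image is a rational scalar on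
`T(X)` (`E := End_Hdg T(X)_ℚ = ℚ`). Its proof applies that hypothesis to ONE endomorphism, `π_T F_c π_T`, which
is `q`-SELF-ADJOINT (`F_c` and `π_T` are). This file records the resulting STRONGER theorem: it suffices that
every `q`-self-adjoint such endomorphism is a rational scalar on `T(X)`. By Zarhin (the adjoint involution of
`q` on the field `E` is the identity if `E` is totally real and complex conjugation if `E` is CM) the
self-adjoint elements of `E` form its maximal totally real subfield `E₀`, so the hypothesis reads `E₀ = ℚ`:
`E = ℚ` or `E` an IMAGINARY QUADRATIC field — e.g. `K3^{[2]}`-type fourfolds with complex multiplication by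
`ℚ(√−d)` at EVERY Picard rank, including the partner-free ranks `ρ(X) ≤ 3` reached by no other file of the
route.

* `exists_transcendentalScalar_of_classEndomorphism_of_selfAdjoint` — block form of `F_c` under the weaker
  hypothesis (the proof of the `E = ℚ` version verbatim, plus the self-adjointness of `π_T F_c π_T`);
* `mem_algebraicClasses_two_of_selfAdjointEndomorphisms_scalar`, `hodgeConjectureFor_of_selfAdjointEndomorphisms_scalar`
  — HC⁴(X) in every degree, modulo {`VerbitskyGuan_cohomology_K3HilbertSquareType`,
  `OGrady2008_dualBBFClass_algebraic`, `Voisin2003_cupProduct_algebraicClasses`} only.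

No definition, no sorry. References: Yu. Zarhin, J. reine angew. Math. 341 (1983) Thm. 1.5.1, Thm. 1.6;
S. Novario, Kyoto J. Math. 66 (2026) Thm. 6.2; K. O'Grady, *Mat. Contemp.* (2008) §3.
-/

noncomputable section

set_option linter.dupNamespace false

open Module CategoryTheory
open Literature.AlgebraicTopology.SingularHomology Literature.Geometry.Kaehler
open Literature.AlgebraicGeometry Literature.AlgebraicGeometry.Motives Literature.AlgebraicGeometry.HodgeTheory
open Literature.AlgebraicGeometry.Hyperkaehler Literature.AlgebraicGeometry.Surfaces
open Summit.HodgeConjecture.HodgeConjecture.Theorems.NikulinTwinTransport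
open Summit.HodgeConjecture.HodgeConjecture.Theorems.MarkmanPartnerTransport.BBFPositivity

namespace Summit.HodgeConjecture.HodgeConjecture.Theorems.MarkmanPartnerTransport.PartnerLattice

/-- `MarkedK3Sq[X, φ, P, z]`: VERBATIM the `let MarkedK3Sq := …` binder of the route declarations of
MarkmanPartnerTransport (clauses (m1)–(m6)). Local notation only. -/
local notation3 (prettyPrint := false) "MarkedK3Sq[" X ", " φ ", " P ", " z "]" =>
  (((IsIntegralClass P ∧ ∀ Q : complexBetti X (2 * 4), IsIntegralClass Q → ∃ n : ℤ, Q = n • P) ∧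
    (∀ c : complexBetti X 2, IsIntegralClass c ↔ ∃ v : K3HilbertIndex → ℤ, φ c = fun i => (v i : ℂ)) ∧
    (∀ a : complexBetti X 2, cupPowTwo a 4 = ((3 : ℂ) * (k3HilbertForm 2 (φ a) (φ a)) ^ 2) • P) ∧
    (IsOfHodgeType 4 X 2 2 0 (LinearEquiv.symm φ z) ∧
      ∀ τ : complexBetti X 2, IsOfHodgeType 4 X 2 2 0 τ → ∃ t : ℂ, τ = t • LinearEquiv.symm φ z) ∧
    (∀ c : complexBetti X 2, IsOfHodgeType 4 X 2 1 1 c ↔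
      (k3HilbertForm 2 (φ c) z = 0 ∧ k3HilbertForm 2 (φ c) (star z) = 0)) ∧
    (k3HilbertForm 2 z z = 0 ∧ 0 < (k3HilbertForm 2 (star z) z).re)))

/-- `Cup3[c, y, w] = (c ∪ y) ∪ w ∈ H⁸` for `c ∈ H⁴`, `y, w ∈ H²`. Local notation only. -/
local notation3 (prettyPrint := false) "Cup3[" c ", " y ", " w "]" =>
  cupProduct (rfl : 2 * 3 + 2 = 2 * 4) (cupProduct (rfl : 2 * 2 + 2 = 2 * 3) c y) w

variable {X : SchemeOver ℂ} {φ : complexBetti X 2 ≃ₗ[ℂ] (K3HilbertIndex → ℂ)} {P : complexBetti X (2 * 4)}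
  {z : K3HilbertIndex → ℂ}

/-- `hQXsa[X, φ]`: every `q`-SELF-ADJOINT rational Hodge endomorphism of `H²(X)` killing `N¹(X)` with
`q`-transcendental image is a rational scalar on `T(X)` (`E₀ = ℚ`). Local notation only. -/
local notation3 (prettyPrint := false) "hQXsa[" X ", " φ "]" =>
  ∀ f : complexBetti X 2 →ₗ[ℂ] complexBetti X 2,
    (∀ y, IsRationalClass y → IsRationalClass (f y)) →
    (∀ (i j : ℕ) y, IsOfHodgeType 4 X 2 i j y → IsOfHodgeType 4 X 2 i j (f y)) →
    (∀ d : complexBetti X 2, d ∈ algebraicClasses X 1 → f d = 0) →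
    (∀ y : complexBetti X 2, ∀ d : complexBetti X 2, d ∈ algebraicClasses X 1 →
      k3HilbertForm 2 (φ (f y)) (φ d) = 0) →
    (∀ y w : complexBetti X 2, k3HilbertForm 2 (φ (f y)) (φ w) = k3HilbertForm 2 (φ y) (φ (f w))) →
    ∃ a : ℚ, ∀ y : complexBetti X 2,
      (∀ d : complexBetti X 2, d ∈ algebraicClasses X 1 → k3HilbertForm 2 (φ y) (φ d) = 0) →
      f y = (a : ℂ) • y

/-- **Block form of the class endomorphism under the self-adjoint hypothesis.** As
`exists_transcendentalScalar_of_classEndomorphism`, but the scalar hypothesis is used only for the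
`q`-self-adjoint endomorphism `π_T F π_T` (`F` and `π_T` are `q`-self-adjoint): `π_T F` kills `N¹(X)`,
`π_T F π_T = a` on `T(X)` with `a ∈ ℚ`, and `q(F y, w) = a·q(y, w) + (q(F y_N, w_N) − a·q(y_N, w_N))`.
[cite: Zarhin1983HodgeGroupsK3, Thm. 1.5.1] [cite: Novario2026HodgeClassesHilbertSquares, Thm. 6.2] -/
theorem exists_transcendentalScalar_of_classEndomorphism_of_selfAdjoint
    (hX : IsSmoothProjective 4 X) (hM : MarkedK3Sq[X, φ, P, z]) (hQX : hQXsa[X, φ])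
    {c : complexBetti X (2 * 2)} (hcrat : IsRationalClass c) (hc22 : IsOfHodgeType 4 X (2 * 2) 2 2 c)
    {F : complexBetti X 2 →ₗ[ℂ] complexBetti X 2}
    (hF : ∀ y w : complexBetti X 2, Cup3[c, y, w] = (k3HilbertForm 2 (φ (F y)) (φ w)) • P) :
    ∃ (πT : complexBetti X 2 →ₗ[ℂ] complexBetti X 2) (a : ℚ),
      (∀ y : complexBetti X 2, y - πT y ∈ algebraicClasses X 1) ∧
      (∀ n ∈ algebraicClasses X 1, ∀ w : complexBetti X 2, k3HilbertForm 2 (φ n) (φ (πT w)) = 0) ∧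
      ∀ y w : complexBetti X 2, k3HilbertForm 2 (φ (F y)) (φ w) =
        (a : ℂ) * k3HilbertForm 2 (φ y) (φ w) +
          (k3HilbertForm 2 (φ (F (y - πT y))) (φ (w - πT w)) -
            (a : ℂ) * k3HilbertForm 2 (φ (y - πT y)) (φ (w - πT w))) := by
  classical
  have hFrat : ∀ y, IsRationalClass y → IsRationalClass (F y) :=
    fun y hy => isRationalClass_classEndomorphism hX hM hF hcrat hy
  have hFh : ∀ (i j : ℕ) y, IsOfHodgeType 4 X 2 i j y → IsOfHodgeType 4 X 2 i j (F y) :=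
    fun i j y hy => isOfHodgeType_classEndomorphism hX hM hF hc22 hy
  have hFadj : ∀ y w, k3HilbertForm 2 (φ (F y)) (φ w) = k3HilbertForm 2 (φ y) (φ (F w)) :=
    classEndomorphism_selfAdjoint hX hM hF
  obtain ⟨πT, hT1, hT2, hT3, hT4, hT5, hT6, hT7⟩ := exists_transcendentalProjector hX hM
  have hN11 : ∀ d ∈ algebraicClasses X 1, IsOfHodgeType 4 X 2 1 1 d := fun d hd =>
    isOfHodgeType_of_mem_algebraicClasses_of_isSmoothProjective hX 1 hd
  have hNT : ∀ n ∈ algebraicClasses X 1, ∀ w, k3HilbertForm 2 (φ n) (φ (πT w)) = 0 := fun n hn w => by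
    rw [k3HilbertForm_comm]; exact hT3 w n hn
  -- Claim A: `πT (F d) = 0` for `d ∈ N¹(X)`
  have hA : ∀ d ∈ algebraicClasses X 1, πT (F d) = 0 := by
    have hspan := supportedClasses_eq_span_isRationalClass hX 2 1
    change algebraicClasses X 1 = Submodule.span ℂ
      {c : complexBetti X 2 | IsRationalClass c ∧ c ∈ algebraicClasses X 1} at hspan
    intro d hd
    rw [hspan] at hd
    have hle : Submodule.span ℂ {c : complexBetti X 2 | IsRationalClass c ∧ c ∈ algebraicClasses X 1} ≤
        LinearMap.ker (πT ∘ₗ F) := by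
      refine Submodule.span_le.2 ?_
      rintro d ⟨hdrat, hdalg⟩
      rw [SetLike.mem_coe, LinearMap.mem_ker, LinearMap.comp_apply]
      have hu_alg : πT (F d) ∈ algebraicClasses X 1 :=
        lefschetzOneOne_rational_holds hX _ (hT5 _ (hFrat _ hdrat)) (hT7 1 1 _ (hFh 1 1 _ (hN11 d hdalg)))
      exact k3HilbertForm_radical_algebraicClasses_one_eq_zero hX hM hu_alg (hT3 (F d))
    simpa only [LinearMap.mem_ker, LinearMap.comp_apply] using hle hd
  -- Claim C: `πT F πT` is a rational scalar `a` on `T(X)`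
  obtain ⟨a, ha⟩ := hQX (πT ∘ₗ F ∘ₗ πT)
    (fun y hy => by rw [LinearMap.comp_apply, LinearMap.comp_apply]; exact hT5 _ (hFrat _ (hT5 _ hy)))
    (fun i j y hy => by
      rw [LinearMap.comp_apply, LinearMap.comp_apply]; exact hT7 i j _ (hFh i j _ (hT7 i j _ hy)))
    (fun d hd => by rw [LinearMap.comp_apply, LinearMap.comp_apply, hT1 d hd, map_zero, map_zero])
    (fun y d hd => by rw [LinearMap.comp_apply, LinearMap.comp_apply]; exact hT3 _ d hd)
    (fun y w => by
      rw [LinearMap.comp_apply, LinearMap.comp_apply, LinearMap.comp_apply, LinearMap.comp_apply, hT6,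
        hFadj, hT6])
  refine ⟨πT, a, hT4, hNT, fun y w => ?_⟩
  -- `q(F (πT y), w) = a · q(πT y, w)`
  have hTT : k3HilbertForm 2 (φ (F (πT y))) (φ w) = (a : ℂ) * k3HilbertForm 2 (φ (πT y)) (φ w) := by
    have hw : w = (w - πT w) + πT w := by abel
    have h1 : k3HilbertForm 2 (φ (F (πT y))) (φ (w - πT w)) = 0 := by
      rw [hFadj, k3HilbertForm_comm, ← hT6, hA _ (hT4 w), map_zero, k3HilbertForm_comm, k3HilbertForm_apply]
      simp
    have h2 : k3HilbertForm 2 (φ (F (πT y))) (φ (πT w)) =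
        (a : ℂ) * k3HilbertForm 2 (φ (πT y)) (φ (πT w)) := by
      have e1 : πT (F (πT y)) = (a : ℂ) • πT y := by
        have := ha (πT y) (hT3 y)
        rwa [LinearMap.comp_apply, LinearMap.comp_apply, hT2 (πT y) (hT3 y)] at this
      rw [← hT6, e1, map_smul, k3HilbertForm_smul_left, hT6 y w, hT6 y (πT w), hT2 (πT w) (hT3 w)]
    have h3 : k3HilbertForm 2 (φ (πT y)) (φ (w - πT w)) = 0 := by
      rw [k3HilbertForm_comm]; exact hNT _ (hT4 w) _
    conv_lhs => rw [hw, map_add, k3HilbertForm_add_right, h1, zero_add, h2]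
    conv_rhs => rw [hw, map_add, k3HilbertForm_add_right, h3, zero_add]
  -- `q(F y_N, πT w) = 0`
  have hNT' : k3HilbertForm 2 (φ (F (y - πT y))) (φ (πT w)) = 0 := by
    rw [← hT6, hA _ (hT4 y), map_zero, k3HilbertForm_apply]; simp
  have hy : y = (y - πT y) + πT y := by abel
  have hw : w = (w - πT w) + πT w := by abel
  have lhs : k3HilbertForm 2 (φ (F y)) (φ w) =
      k3HilbertForm 2 (φ (F (y - πT y))) (φ (w - πT w)) +
        (a : ℂ) * k3HilbertForm 2 (φ (πT y)) (φ w) := by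
    conv_lhs => rw [hy, map_add, map_add, k3HilbertForm_add_left, hTT]
    congr 1
    conv_lhs => rw [hw, map_add, k3HilbertForm_add_right, hNT', add_zero]
  have qsplit : k3HilbertForm 2 (φ y) (φ w) =
      k3HilbertForm 2 (φ (y - πT y)) (φ (w - πT w)) + k3HilbertForm 2 (φ (πT y)) (φ w) := by
    conv_lhs => rw [hy, map_add, k3HilbertForm_add_left]
    congr 1
    conv_lhs => rw [hw, map_add, k3HilbertForm_add_right, hNT _ (hT4 y) w, add_zero]
  rw [lhs, qsplit]; ring

/-- **HC⁴ in degree `4` for marked `K3^{[2]}`-type fourfolds with `E₀ = ℚ`** (every `q`-self-adjoint rational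
Hodge endomorphism of `T(X)` a rational scalar: `E = ℚ` or `E` imaginary quadratic), partner-free, at every
Picard rank: a rational `(2,2)`-class is algebraic. [cite: Zarhin1983HodgeGroupsK3, Thm. 1.5.1]
[cite: Novario2026HodgeClassesHilbertSquares, Thm. 6.2] [cite: OGrady2008NumericalK3Square, §3] -/
theorem mem_algebraicClasses_two_of_selfAdjointEndomorphisms_scalar
    (hV : VerbitskyGuan_cohomology_K3HilbertSquareType) (hO : OGrady2008_dualBBFClass_algebraic)
    (hcup : Voisin2003_cupProduct_algebraicClasses)
    (hX : IsSmoothProjective 4 X) (hK : IsOfK3HilbertSquareType X) (hM : MarkedK3Sq[X, φ, P, z])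
    (hQX : hQXsa[X, φ]) {c : complexBetti X (2 * 2)} (hcrat : IsRationalClass c)
    (hc22 : IsOfHodgeType 4 X (2 * 2) 2 2 c) : c ∈ algebraicClasses X 2 := by
  classical
  obtain ⟨F, hF⟩ := exists_classEndomorphism hX hM c
  have hFadj : ∀ y w, k3HilbertForm 2 (φ (F y)) (φ w) = k3HilbertForm 2 (φ y) (φ (F w)) :=
    classEndomorphism_selfAdjoint hX hM hF
  obtain ⟨πT, a, hT4, hNT, hβ⟩ :=
    exists_transcendentalScalar_of_classEndomorphism_of_selfAdjoint hX hM hQX hcrat hc22 hF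
  set qXform : LinearMap.BilinForm ℂ (complexBetti X 2) :=
    (Matrix.toBilin' (Matrix.map (k3HilbertGram 2) (Int.cast : ℤ → ℂ))).compl₁₂
      (φ : complexBetti X 2 →ₗ[ℂ] (K3HilbertIndex → ℂ)) (φ : complexBetti X 2 →ₗ[ℂ] (K3HilbertIndex → ℂ))
    with hqXform
  have hqXapp : ∀ y w, qXform y w = k3HilbertForm 2 (φ y) (φ w) := fun y w => by
    rw [hqXform, LinearMap.compl₁₂_apply, qC_apply]; rfl
  set β : complexBetti X 2 →ₗ[ℂ] complexBetti X 2 →ₗ[ℂ] ℂ :=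
    qXform.compl₁₂ F LinearMap.id - (a : ℂ) • qXform with hβraw
  have hβdef : ∀ y w, β y w =
      k3HilbertForm 2 (φ (F y)) (φ w) - (a : ℂ) * k3HilbertForm 2 (φ y) (φ w) := by
    intro y w
    rw [hβraw, LinearMap.sub_apply, LinearMap.smul_apply, LinearMap.sub_apply, LinearMap.smul_apply,
      LinearMap.compl₁₂_apply, LinearMap.id_apply, hqXapp, hqXapp, smul_eq_mul]
  clear_value β
  have hβsymm : ∀ y w, β y w = β w y := fun y w => by
    rw [hβdef, hβdef, hFadj, k3HilbertForm_comm 2 (φ y) (φ (F w)), k3HilbertForm_comm 2 (φ y) (φ w)]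
  have hqr : ∀ n ∈ algebraicClasses X 1, ∀ y : complexBetti X 2,
      k3HilbertForm 2 (φ n) (φ (y - πT y)) = k3HilbertForm 2 (φ n) (φ y) := by
    intro n hn y
    rw [map_sub, sub_eq_add_neg, k3HilbertForm_add_right, ← neg_one_smul ℂ, k3HilbertForm_smul_right,
      hNT n hn y, mul_zero, add_zero]
  obtain ⟨c', hc'alg, hc'⟩ := exists_algebraicClass_of_symmetricForm hO hcup hX hK hM (a : ℂ) β hβsymm
    (fun y => y - πT y) hT4 hqr
  have hcup3 : ∀ y w : complexBetti X 2, Cup3[c, y, w] = Cup3[c', y, w] := fun y w => by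
    rw [hF, hc', hβ, hβdef]
  exact eq_of_cup3_eq hV hX hK hcup3 ▸ hc'alg

/-- **HC⁴ for marked projective `K3^{[2]}`-type fourfolds with `E₀ = ℚ` (`E = ℚ` or `E` imaginary quadratic), at
EVERY Picard rank, partner-free**, modulo {Verbitsky–Guan, O'Grady, Voisin}: degree `4` by the previous theorem,
the others by Lefschetz `(1,1)` and hard Lefschetz. [cite: Zarhin1983HodgeGroupsK3, Thm. 1.5.1]
[cite: Novario2026HodgeClassesHilbertSquares, Thm. 6.2] [cite: VoisinHodgeI2002, Thm. 11.30 and Thm. 6.25] -/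
theorem hodgeConjectureFor_of_selfAdjointEndomorphisms_scalar
    (hV : VerbitskyGuan_cohomology_K3HilbertSquareType) (hO : OGrady2008_dualBBFClass_algebraic)
    (hcup : Voisin2003_cupProduct_algebraicClasses)
    (hX : IsSmoothProjective 4 X) (hK : IsOfK3HilbertSquareType X) (hM : MarkedK3Sq[X, φ, P, z])
    (hQX : hQXsa[X, φ]) : HodgeConjectureFor 4 X :=
  ⟨nonempty_hodgeModel_holds hX, fun p c hc hH ↦
    hodgeClasses_algebraic_fourfold_of_hodgeTwoTwo lefschetzOneOne_rational_holds
      (nonempty_hardLefschetzNFold_holds 4 X) hX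
      (fun _ hc' hH' ↦ mem_algebraicClasses_two_of_selfAdjointEndomorphisms_scalar hV hO hcup hX hK hM hQX hc' hH')
      p c hc hH⟩

end Summit.HodgeConjecture.HodgeConjecture.Theorems.MarkmanPartnerTransport.PartnerLattice

end
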